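import Literature.Barriers.CriticalPhenomena.SupercriticalSAWSpaceFillingBoxesShift
import Literature.Probability.Percolation.DynamicSiteRenormalization
import HarnessLib

/-!
# Edge sets of `ℤ²`: vertices, width / height / line-width predicates, normal position

Topic `Literature/Probability/RandomPlanarGeometry` (infrastructure for `SAWWidePolygons.lean`, the
wide self-avoiding polygons `WSAP^u_m` of Duminil-Copin–Ganguly–Hammond–Manolescu, *Bounding the
number of self-avoiding walks: Hammersley–Welsh with polygon insertion*, Ann. Probab. 48 (2020),
arXiv:1809.00760, §3.1; continues `SupercriticalSAWSpaceFillingBoxesShift.lean`, whose translates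
`shiftEdges c E` of finite edge sets of `ℤ²` are used).

Source vocabulary (§3.1 of the paper): "the width of `p` is `width(p) := x_max(P) − x_min(P)`,
where `P` is any representative of the equivalence class `p`. The line-width of `p` is
`lwidth(p) := max{x_max(P ∩ ℓ_y) − x_min(P ∩ ℓ_y) : y ∈ ℤ, P ∩ ℓ_y ≠ ∅}`, where `ℓ_y` is the
horizontal line `ℤ × {y}`"; the height is the extent of the second coordinate (§1.1). Polygons are
counted UP TO TRANSLATION; here a class is represented by its NORMAL translate.

## Contents (namespace `Literature.Probability.RandomPlanarGeometry.SAW`)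

  `mem_vertsOf_shiftEdges`, `vertsOf_union`;
  `shiftEdges_shiftEdges`, `shiftEdges_zero`.
* `HasWidthGe E w`, `HasHeightLe E h`, `HasLWidthGe E u` — "`width ≥ w`", "`height ≤ h`",
  "`lwidth ≥ u`" as predicates on vertex pairs; translation invariant (`…_shiftEdges_iff`).
* `IsNormal E` — normal position (all vertices in the closed first quadrant, a vertex on each
  axis); `exists_shift_isNormal`, `shift_eq_of_isNormal` (existence and uniqueness of the normal
  translate); `normalise E`, with `isNormal_normalise`, `normalise_eq_self`, `normalise_shiftEdges`
  (a complete translation invariant).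

## Design choices

* Width, height and line-width enter the source only through inequalities (`lwidth ≥ u`,
  `height ≤ 16u`, `width ≥ u/2`, `height ≤ u`), so they are PREDICATES over vertex pairs, not
  `max − min` functions (no junk values on empty sets).
* `siteXY a b = ![a, b]` names sites by coordinates.
-/

noncomputable section

open Finset SimpleGraph Literature.Probability.LatticeModels Literature.Probability.Percolation
open Literature.Barriers.CriticalPhenomena.SupercriticalSAW (shiftEdges card_shiftEdges
  mem_shiftEdges_iff shiftEdges_injective)
open Literature.Probability.Percolation.SiteGadgetSystem (vertsOf mem_vertsOf)

namespace Literature.Probability.RandomPlanarGeometry.SAW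

/-! ### Vertices of an edge set -/

/-! The vertex set `vertsOf E = E.biUnion Sym2.toFinset` of a finite edge set of `ℤ²` and
`mem_vertsOf : v ∈ vertsOf E ↔ ∃ e ∈ E, v ∈ e` are the tree's
(`Literature.Probability.Percolation.SiteGadgetSystem.vertsOf`, DynamicSiteRenormalization.lean). -/

/-- An endpoint of an edge of `E` is a vertex of `E`.
[cite: DuminilCopinGangulyHammondManolescu2020, §3.1 (polygons up to translation: "P is any representative of the equivalence class p")] -/
theorem mem_verts_of_mem {E : Finset (Sym2 (Site 2))} {e : Sym2 (Site 2)} (he : e ∈ E) {v : Site 2}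
    (hv : v ∈ e) : v ∈ vertsOf E :=
  mem_vertsOf.2 ⟨e, he, hv⟩

/-- `vertsOf` is monotone.
[cite: DuminilCopinGangulyHammondManolescu2020, §3.1 (polygons up to translation: "P is any representative of the equivalence class p")] -/
theorem vertsOf_mono {E F : Finset (Sym2 (Site 2))} (h : E ⊆ F) : vertsOf E ⊆ vertsOf F := by
  intro v hv
  obtain ⟨e, he, hve⟩ := mem_vertsOf.1 hv
  exact mem_verts_of_mem (h he) hve

/-- `vertsOf (E ∪ F) = vertsOf E ∪ vertsOf F`.
[cite: DuminilCopinGangulyHammondManolescu2020, §3.1 (polygons up to translation: "P is any representative of the equivalence class p")] -/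
theorem vertsOf_union (E F : Finset (Sym2 (Site 2))) : vertsOf (E ∪ F) = vertsOf E ∪ vertsOf F := by
  ext v; simp only [mem_vertsOf, mem_union]
  constructor
  · rintro ⟨e, he | he, hv⟩
    · exact Or.inl ⟨e, he, hv⟩
    · exact Or.inr ⟨e, he, hv⟩
  · rintro (⟨e, he, hv⟩ | ⟨e, he, hv⟩)
    · exact ⟨e, Or.inl he, hv⟩
    · exact ⟨e, Or.inr he, hv⟩

/-- The vertices of a translate are the translates of the vertices.
[cite: DuminilCopinGangulyHammondManolescu2020, §3.1 (polygons up to translation: "P is any representative of the equivalence class p")] -/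
theorem mem_vertsOf_shiftEdges {E : Finset (Sym2 (Site 2))} {t v : Site 2} :
    v ∈ vertsOf (shiftEdges t E) ↔ v - t ∈ vertsOf E := by
  simp only [mem_vertsOf, mem_shiftEdges_iff]
  constructor
  · rintro ⟨e, ⟨e', he', rfl⟩, hv⟩
    refine ⟨e', he', ?_⟩
    induction e' using Sym2.ind with
    | _ a b =>
      simp only [Sym2.map_mk, Sym2.mem_iff] at hv ⊢
      rcases hv with rfl | rfl <;> simp
  · rintro ⟨e', he', hv⟩
    refine ⟨Sym2.map (fun w => w + t) e', ⟨e', he', rfl⟩, ?_⟩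
    induction e' using Sym2.ind with
    | _ a b =>
      simp only [Sym2.map_mk, Sym2.mem_iff] at hv ⊢
      rcases hv with h | h
      · exact Or.inl (by rw [← h]; abel)
      · exact Or.inr (by rw [← h]; abel)

/-- `v + t` is a vertex of `E + t` iff `v` is a vertex of `E`.
[cite: DuminilCopinGangulyHammondManolescu2020, §3.1 (polygons up to translation: "P is any representative of the equivalence class p")] -/
theorem add_mem_vertsOf_shiftEdges {E : Finset (Sym2 (Site 2))} {t v : Site 2} :
    v + t ∈ vertsOf (shiftEdges t E) ↔ v ∈ vertsOf E := by
  rw [mem_vertsOf_shiftEdges, add_sub_cancel_right]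

/-- `vertsOf` of a translate is nonempty iff `vertsOf` is.
[cite: DuminilCopinGangulyHammondManolescu2020, §3.1 (polygons up to translation: "P is any representative of the equivalence class p")] -/
theorem vertsOf_shiftEdges_nonempty {E : Finset (Sym2 (Site 2))} {t : Site 2} :
    (vertsOf (shiftEdges t E)).Nonempty ↔ (vertsOf E).Nonempty := by
  constructor
  · rintro ⟨v, hv⟩; exact ⟨v - t, mem_vertsOf_shiftEdges.1 hv⟩
  · rintro ⟨v, hv⟩; exact ⟨v + t, add_mem_vertsOf_shiftEdges.2 hv⟩

/-- Translating by `s` then by `t` is translating by `s + t`.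
[cite: DuminilCopinGangulyHammondManolescu2020, §3.1 (polygons up to translation: "P is any representative of the equivalence class p")] -/
theorem shiftEdges_shiftEdges (s t : Site 2) (E : Finset (Sym2 (Site 2))) :
    shiftEdges t (shiftEdges s E) = shiftEdges (s + t) E := by
  ext e
  simp only [mem_shiftEdges_iff]
  constructor
  · rintro ⟨e₁, ⟨e₂, he₂, rfl⟩, rfl⟩
    refine ⟨e₂, he₂, ?_⟩
    rw [Sym2.map_map]; congr 1; funext w; simp [add_assoc]
  · rintro ⟨e₂, he₂, rfl⟩
    refine ⟨Sym2.map (fun w => w + s) e₂, ⟨e₂, he₂, rfl⟩, ?_⟩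
    rw [Sym2.map_map]; congr 1; funext w; simp [add_assoc]

/-- Translating by `0` does nothing.
[cite: DuminilCopinGangulyHammondManolescu2020, §3.1 (polygons up to translation: "P is any representative of the equivalence class p")] -/
theorem shiftEdges_zero (E : Finset (Sym2 (Site 2))) : shiftEdges 0 E = E := by
  ext e
  simp only [mem_shiftEdges_iff, add_zero]
  constructor
  · rintro ⟨e', he', rfl⟩
    rw [show (fun w : Site 2 => w) = id from rfl, Sym2.map_id, id]; exact he'
  · intro he
    exact ⟨e, he, by rw [show (fun w : Site 2 => w) = id from rfl, Sym2.map_id, id]⟩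

/-! ### Width, height, line-width as predicates -/

/-- "`width(E) ≥ w`": two vertices whose first coordinates differ by at least `w`.
[cite: DuminilCopinGangulyHammondManolescu2020, §3.1 (width)] -/
def HasWidthGe (E : Finset (Sym2 (Site 2))) (w : ℕ) : Prop :=
  ∃ a ∈ vertsOf E, ∃ b ∈ vertsOf E, a 0 + w ≤ b 0

/-- "`height(E) ≤ h`": any two vertices have second coordinates differing by at most `h`.
[cite: DuminilCopinGangulyHammondManolescu2020, §1.1 (height) and §3.1] -/
def HasHeightLe (E : Finset (Sym2 (Site 2))) (h : ℕ) : Prop :=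
  ∀ a ∈ vertsOf E, ∀ b ∈ vertsOf E, b 1 ≤ a 1 + h

/-- "`lwidth(E) ≥ u`": two vertices ON ONE HORIZONTAL LINE whose first coordinates differ by at
least `u` (`lwidth(p) = max_y (x_max(P ∩ ℓ_y) − x_min(P ∩ ℓ_y))`).
[cite: DuminilCopinGangulyHammondManolescu2020, §3.1 (line-width)] -/
def HasLWidthGe (E : Finset (Sym2 (Site 2))) (u : ℕ) : Prop :=
  ∃ a ∈ vertsOf E, ∃ b ∈ vertsOf E, a 1 = b 1 ∧ a 0 + u ≤ b 0

/-- Line-width at least `u` forces width at least `u` ("`width(p) ≥ lwidth(p)`").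
[cite: DuminilCopinGangulyHammondManolescu2020, §3.1] -/
theorem HasLWidthGe.hasWidthGe {E : Finset (Sym2 (Site 2))} {u : ℕ} (h : HasLWidthGe E u) :
    HasWidthGe E u := by
  obtain ⟨a, ha, b, hb, -, hab⟩ := h
  exact ⟨a, ha, b, hb, hab⟩

/-- `HasHeightLe` is monotone in the bound.
[cite: DuminilCopinGangulyHammondManolescu2020, §3.1 (width, line-width, height)] -/
theorem HasHeightLe.mono {E : Finset (Sym2 (Site 2))} {h h' : ℕ} (hE : HasHeightLe E h) (hh : h ≤ h') :
    HasHeightLe E h' :=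
  fun a ha b hb => (hE a ha b hb).trans (by gcongr)

/-- `HasLWidthGe` is antitone in the bound.
[cite: DuminilCopinGangulyHammondManolescu2020, §3.1 (width, line-width, height)] -/
theorem HasLWidthGe.anti {E : Finset (Sym2 (Site 2))} {u u' : ℕ} (hE : HasLWidthGe E u) (hu : u' ≤ u) :
    HasLWidthGe E u' := by
  obtain ⟨a, ha, b, hb, hy, hab⟩ := hE
  exact ⟨a, ha, b, hb, hy, by omega⟩

/-- Width is translation invariant.
[cite: DuminilCopinGangulyHammondManolescu2020, §3.1 (width, line-width, height)] -/
theorem hasWidthGe_shiftEdges_iff {E : Finset (Sym2 (Site 2))} {t : Site 2} {w : ℕ} :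
    HasWidthGe (shiftEdges t E) w ↔ HasWidthGe E w := by
  constructor
  · rintro ⟨a, ha, b, hb, hab⟩
    refine ⟨a - t, mem_vertsOf_shiftEdges.1 ha, b - t, mem_vertsOf_shiftEdges.1 hb, ?_⟩
    simp only [Pi.sub_apply]; linarith
  · rintro ⟨a, ha, b, hb, hab⟩
    refine ⟨a + t, add_mem_vertsOf_shiftEdges.2 ha, b + t, add_mem_vertsOf_shiftEdges.2 hb, ?_⟩
    simp only [Pi.add_apply]; linarith

/-- Height is translation invariant.
[cite: DuminilCopinGangulyHammondManolescu2020, §3.1 (width, line-width, height)] -/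
theorem hasHeightLe_shiftEdges_iff {E : Finset (Sym2 (Site 2))} {t : Site 2} {h : ℕ} :
    HasHeightLe (shiftEdges t E) h ↔ HasHeightLe E h := by
  constructor
  · intro hE a ha b hb
    have := hE (a + t) (add_mem_vertsOf_shiftEdges.2 ha) (b + t) (add_mem_vertsOf_shiftEdges.2 hb)
    simp only [Pi.add_apply] at this; linarith
  · intro hE a ha b hb
    have := hE (a - t) (mem_vertsOf_shiftEdges.1 ha) (b - t) (mem_vertsOf_shiftEdges.1 hb)
    simp only [Pi.sub_apply] at this; linarith

/-- Line-width is translation invariant.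
[cite: DuminilCopinGangulyHammondManolescu2020, §3.1 (width, line-width, height)] -/
theorem hasLWidthGe_shiftEdges_iff {E : Finset (Sym2 (Site 2))} {t : Site 2} {u : ℕ} :
    HasLWidthGe (shiftEdges t E) u ↔ HasLWidthGe E u := by
  constructor
  · rintro ⟨a, ha, b, hb, hy, hab⟩
    refine ⟨a - t, mem_vertsOf_shiftEdges.1 ha, b - t, mem_vertsOf_shiftEdges.1 hb, ?_, ?_⟩
    · simp only [Pi.sub_apply, hy]
    · simp only [Pi.sub_apply]; linarith
  · rintro ⟨a, ha, b, hb, hy, hab⟩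
    refine ⟨a + t, add_mem_vertsOf_shiftEdges.2 ha, b + t, add_mem_vertsOf_shiftEdges.2 hb, ?_, ?_⟩
    · simp only [Pi.add_apply, hy]
    · simp only [Pi.add_apply]; linarith

/-! ### Normal position and normalisation -/

/-- Normal position of an edge set of `ℤ²`: every vertex lies in the closed first quadrant, some
vertex lies on each coordinate axis (the bounding box has lower-left corner `0`).
[cite: DuminilCopinGangulyHammondManolescu2020, §3.1 (polygons up to translation: "P is any representative of the equivalence class p")] -/
def IsNormal (E : Finset (Sym2 (Site 2))) : Prop :=
  (∀ v ∈ vertsOf E, 0 ≤ v 0 ∧ 0 ≤ v 1) ∧ (∃ v ∈ vertsOf E, v 0 = 0) ∧ ∃ v ∈ vertsOf E, v 1 = 0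

/-- The site with coordinates `(a, b)`. [folklore] -/
def siteXY (a b : ℤ) : Site 2 := ![a, b]

/-- First coordinate of `siteXY`.
[cite: DuminilCopinGangulyHammondManolescu2020, §3.1 (polygons up to translation: "P is any representative of the equivalence class p")] -/
@[simp] theorem mkSite_zero (a b : ℤ) : siteXY a b 0 = a := rfl

/-- Second coordinate of `siteXY`.
[cite: DuminilCopinGangulyHammondManolescu2020, §3.1 (polygons up to translation: "P is any representative of the equivalence class p")] -/
@[simp] theorem mkSite_one (a b : ℤ) : siteXY a b 1 = b := rfl

/-- Every edge set with a vertex has a normal translate: shift by minus the coordinatewise minima.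
[cite: DuminilCopinGangulyHammondManolescu2020, §3.1 (polygons up to translation: "P is any representative of the equivalence class p")] -/
theorem exists_shift_isNormal {E : Finset (Sym2 (Site 2))} (hne : (vertsOf E).Nonempty) :
    ∃ t : Site 2, IsNormal (shiftEdges t E) := by
  obtain ⟨vx, hvx, hx⟩ := exists_min_image (vertsOf E) (fun v => v 0) hne
  obtain ⟨vy, hvy, hy⟩ := exists_min_image (vertsOf E) (fun v => v 1) hne
  refine ⟨siteXY (-vx 0) (-vy 1), ?_, ?_, ?_⟩
  · intro v hv
    have hv' := mem_vertsOf_shiftEdges.1 hv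
    have h0 := hx _ hv'
    have h1 := hy _ hv'
    simp only [Pi.sub_apply, mkSite_zero, mkSite_one] at h0 h1
    constructor <;> linarith
  · exact ⟨vx + siteXY (-vx 0) (-vy 1), add_mem_vertsOf_shiftEdges.2 hvx, by simp⟩
  · exact ⟨vy + siteXY (-vx 0) (-vy 1), add_mem_vertsOf_shiftEdges.2 hvy, by simp⟩

/-- Two sites of `ℤ²` with equal coordinates are equal. [folklore] -/
private theorem site_ext {v w : Site 2} (h0 : v 0 = w 0) (h1 : v 1 = w 1) : v = w := by
  funext i; fin_cases i <;> assumption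

/-- Normal position pins down the translate: if `E + s` and `E + t` are both normal then `s = t`.
[cite: DuminilCopinGangulyHammondManolescu2020, §3.1 (polygons up to translation: "P is any representative of the equivalence class p")] -/
theorem shift_eq_of_isNormal {E : Finset (Sym2 (Site 2))} {s t : Site 2}
    (hs : IsNormal (shiftEdges s E)) (ht : IsNormal (shiftEdges t E)) : s = t := by
  obtain ⟨hs0, ⟨a, ha, ha0⟩, ⟨b, hb, hb0⟩⟩ := hs
  obtain ⟨ht0, ⟨a', ha', ha'0⟩, ⟨b', hb', hb'0⟩⟩ := ht
  -- compare minima of the first coordinate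
  have h1 : s 0 ≤ t 0 := by
    have hmem : a - s + t ∈ vertsOf (shiftEdges t E) :=
      add_mem_vertsOf_shiftEdges.2 (mem_vertsOf_shiftEdges.1 ha)
    have := (ht0 _ hmem).1
    simp only [Pi.add_apply, Pi.sub_apply, ha0] at this; linarith
  have h2 : t 0 ≤ s 0 := by
    have hmem : a' - t + s ∈ vertsOf (shiftEdges s E) :=
      add_mem_vertsOf_shiftEdges.2 (mem_vertsOf_shiftEdges.1 ha')
    have := (hs0 _ hmem).1
    simp only [Pi.add_apply, Pi.sub_apply, ha'0] at this; linarith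
  have h3 : s 1 ≤ t 1 := by
    have hmem : b - s + t ∈ vertsOf (shiftEdges t E) :=
      add_mem_vertsOf_shiftEdges.2 (mem_vertsOf_shiftEdges.1 hb)
    have := (ht0 _ hmem).2
    simp only [Pi.add_apply, Pi.sub_apply, hb0] at this; linarith
  have h4 : t 1 ≤ s 1 := by
    have hmem : b' - t + s ∈ vertsOf (shiftEdges s E) :=
      add_mem_vertsOf_shiftEdges.2 (mem_vertsOf_shiftEdges.1 hb')
    have := (hs0 _ hmem).2
    simp only [Pi.add_apply, Pi.sub_apply, hb'0] at this; linarith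
  exact site_ext (le_antisymm h1 h2) (le_antisymm h3 h4)

/-- The normal translate of an edge set (itself if it has no vertex).
[cite: DuminilCopinGangulyHammondManolescu2020, §3.1 (polygons up to translation: "P is any representative of the equivalence class p")] -/
def normalise (E : Finset (Sym2 (Site 2))) : Finset (Sym2 (Site 2)) :=
  if h : (vertsOf E).Nonempty then shiftEdges (Classical.choose (exists_shift_isNormal h)) E else E

/-- The normalising translation of an edge set with a vertex.
[cite: DuminilCopinGangulyHammondManolescu2020, §3.1 (polygons up to translation: "P is any representative of the equivalence class p")] -/
def normShift (E : Finset (Sym2 (Site 2))) (h : (vertsOf E).Nonempty) : Site 2 :=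
  Classical.choose (exists_shift_isNormal h)

/-- `normalise E = E + normShift E`.
[cite: DuminilCopinGangulyHammondManolescu2020, §3.1 (polygons up to translation: "P is any representative of the equivalence class p")] -/
theorem normalise_eq (E : Finset (Sym2 (Site 2))) (h : (vertsOf E).Nonempty) :
    normalise E = shiftEdges (normShift E h) E := by
  rw [normalise, dif_pos h]; rfl

/-- The normalisation of an edge set with a vertex is normal.
[cite: DuminilCopinGangulyHammondManolescu2020, §3.1 (polygons up to translation: "P is any representative of the equivalence class p")] -/
theorem isNormal_normalise {E : Finset (Sym2 (Site 2))} (h : (vertsOf E).Nonempty) :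
    IsNormal (normalise E) := by
  rw [normalise_eq E h]
  exact Classical.choose_spec (exists_shift_isNormal h)

/-- A normal edge set is its own normalisation.
[cite: DuminilCopinGangulyHammondManolescu2020, §3.1 (polygons up to translation: "P is any representative of the equivalence class p")] -/
theorem normalise_eq_self {E : Finset (Sym2 (Site 2))} (hE : IsNormal E) : normalise E = E := by
  have hne : (vertsOf E).Nonempty := by obtain ⟨-, ⟨v, hv, -⟩, -⟩ := hE; exact ⟨v, hv⟩
  rw [normalise_eq E hne]
  have h0 : IsNormal (shiftEdges 0 E) := by rw [shiftEdges_zero]; exact hE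
  have h1 : IsNormal (shiftEdges (normShift E hne) E) := Classical.choose_spec (exists_shift_isNormal hne)
  rw [shift_eq_of_isNormal h1 h0, shiftEdges_zero]

/-- Normalisation forgets translations.
[cite: DuminilCopinGangulyHammondManolescu2020, §3.1 (polygons up to translation: "P is any representative of the equivalence class p")] -/
theorem normalise_shiftEdges (t : Site 2) (E : Finset (Sym2 (Site 2))) :
    normalise (shiftEdges t E) = normalise E := by
  by_cases hne : (vertsOf E).Nonempty
  · have hne' : (vertsOf (shiftEdges t E)).Nonempty := vertsOf_shiftEdges_nonempty.2 hne
    rw [normalise_eq _ hne', normalise_eq _ hne, shiftEdges_shiftEdges]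
    have h1 : IsNormal (shiftEdges (t + normShift (shiftEdges t E) hne') E) := by
      rw [← shiftEdges_shiftEdges]
      exact Classical.choose_spec (exists_shift_isNormal hne')
    have h2 : IsNormal (shiftEdges (normShift E hne) E) := Classical.choose_spec (exists_shift_isNormal hne)
    rw [shift_eq_of_isNormal h1 h2]
  · have hne' : ¬ (vertsOf (shiftEdges t E)).Nonempty := fun h => hne (vertsOf_shiftEdges_nonempty.1 h)
    have hE : E = ∅ := by
      by_contra hE
      obtain ⟨e, he⟩ := Finset.nonempty_iff_ne_empty.2 hE
      induction e using Sym2.ind with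
      | _ a b => exact hne ⟨a, mem_verts_of_mem he (Sym2.mem_mk_left a b)⟩
    subst hE
    rw [normalise, dif_neg hne', normalise, dif_neg hne]
    rfl

/-- The normalisation is a translate.
[cite: DuminilCopinGangulyHammondManolescu2020, §3.1 (polygons up to translation: "P is any representative of the equivalence class p")] -/
theorem exists_normalise_eq_shiftEdges (E : Finset (Sym2 (Site 2))) :
    ∃ t : Site 2, normalise E = shiftEdges t E := by
  by_cases h : (vertsOf E).Nonempty
  · exact ⟨normShift E h, normalise_eq E h⟩
  · exact ⟨0, by rw [normalise, dif_neg h, shiftEdges_zero]⟩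

end Literature.Probability.RandomPlanarGeometry.SAW
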